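import Summits.AnomalousDissipation.AnomalousDissipation.Theorems.TaylorGreenLogLoudStates.Negative.LoadBearing

/-!
# Sketch — crux-ideate r1 (gen 2, ideator 2), crux `TaylorGreenLogLoudStates` (stmt-AnomalousDissipation-15060)

First-lemma signatures for the card `stationary-pitchfork-octave-ladder` (folder `idea-stationary-pitchfork-octave-ladder.md`).

* `OctaveLadderAlong` / `OctaveLadder` — the TRANSFER target C⁺: along a GEOMETRIC viscosity sequence
  `ν_j ≤ ν₀ qʲ` the admissible Galerkin steady Taylor–Green states have energies growing at most LINEARLY in the rung
  index `j` ("one energy quantum per octave") and loudness `≥ c`.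
* `logLoudStates_of_octaveLadder` (PROVED): C⁺ ⇒ the crux's conclusion `LogLoudStates tgForce`
  (`E := E₀/log 4 + ΔE/log(1/q)`); `crux_of_octaveLadder` (PROVED): C⁺ ⇒ the route decl, via the landed `logCrux_iff`.
* `head_loss_identity` (statement; provable now by the chain rule + FTC): Bernoulli-with-losses along a streamline of a
  classical steady state — the formal root of the card's SUBSONIC-CORE LAW (design constraint, see the card / NOTES).

Vocabulary: `IsSteadyState`, `tgForce` (landed `Theorems/TaylorGreenLoudGalerkinStates/Negative/LoadBearing.lean`),
`LogLoudStates`, `logCrux_iff`, `log_four_le_log_one_div` (landed `Theorems/TaylorGreenLogLoudStates/Negative/LoadBearing.lean`).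
-/

noncomputable section

set_option linter.dupNamespace false

open scoped InnerProductSpace Topology
open MeasureTheory Filter
open Literature.Analysis.FunctionSpaces Literature.Analysis.FunctionSpaces.Torus
open Summit.AnomalousDissipation.AnomalousDissipation.Theorems.TaylorGreenLoudGalerkinStates.Negative
open Summit.AnomalousDissipation.AnomalousDissipation.Theorems.TaylorGreenLogLoudStates.Negative

namespace Summit.AnomalousDissipation.AnomalousDissipation.Cruxes.TaylorGreenLogLoudStates.IdeasG2I2

/-- **Octave ladder along `ν`**: for every rung `j` and all large resolutions `N` an admissible Galerkin steady state at
`(ν j, N)` for the force `f` with energy `≤ E₀ + j·ΔE` (linear in the rung index) and loudness `≥ c`. -/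
def OctaveLadderAlong (f : UnitAddTorus (Fin 3) → EuclideanSpace ℝ (Fin 3)) (ν : ℕ → ℝ) (E₀ ΔE c : ℝ) : Prop :=
  ∀ j : ℕ, ∀ᶠ N in atTop, ∃ U : UnitAddTorus (Fin 3) → EuclideanSpace ℝ (Fin 3),
    IsSteadyState (ν j) N f U ∧ ∫ x, ‖U x‖ ^ 2 ≤ E₀ + (j : ℝ) * ΔE ∧ c ≤ ν j * gradNormSq U

/-- **Octave ladder** (the transfer target C⁺ of the card): a geometric (or faster) viscosity sequence
`0 < ν_j ≤ ν₀ qʲ`, `0 < q < 1`, `ν₀ ≤ 1/4`, carrying an octave ladder with constants `E₀, ΔE ≥ 0`, `c > 0`. -/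
def OctaveLadder (f : UnitAddTorus (Fin 3) → EuclideanSpace ℝ (Fin 3)) : Prop :=
  ∃ (ν : ℕ → ℝ) (ν₀ q E₀ ΔE c : ℝ), 0 < q ∧ q < 1 ∧ 0 < ν₀ ∧ ν₀ ≤ 1 / 4 ∧ 0 ≤ E₀ ∧ 0 ≤ ΔE ∧ 0 < c ∧
    (∀ j, 0 < ν j ∧ ν j ≤ ν₀ * q ^ j) ∧ OctaveLadderAlong f ν E₀ ΔE c

/-- **Transfer (proved): an octave ladder is log-loud.** With `E := E₀/log 4 + ΔE/log(1/q)`: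
`E₀ + jΔE ≤ E·log(1/ν_j)` because `log(1/ν_j) ≥ log 4` and `log(1/ν_j) ≥ j·log(1/q)`. The logarithm of the crux is the
rung count of the ladder. [folklore] -/
theorem logLoudStates_of_octaveLadder (h : OctaveLadder tgForce) : LogLoudStates tgForce := by
  obtain ⟨ν, ν₀, q, E₀, ΔE, c, hq0, hq1, hν₀0, hν₀4, hE₀, hΔE, hc, hν, hL⟩ := h
  have hqj : ∀ j, ν j ≤ q ^ j := fun j => by
    have h1 := (hν j).2
    have h2 : ν₀ * q ^ j ≤ 1 * q ^ j :=
      mul_le_mul_of_nonneg_right (by linarith) (pow_nonneg hq0.le j)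
    linarith
  have hν4 : ∀ j, 0 < ν j ∧ ν j ≤ 1 / 4 := fun j => by
    refine ⟨(hν j).1, ?_⟩
    have h1 : q ^ j ≤ 1 := pow_le_one₀ hq0.le hq1.le
    have h2 : ν₀ * q ^ j ≤ ν₀ * 1 := mul_le_mul_of_nonneg_left h1 hν₀0.le
    linarith [(hν j).2]
  have hlim : Tendsto ν atTop (𝓝 0) := by
    have hg : Tendsto (fun j => ν₀ * q ^ j) atTop (𝓝 (ν₀ * 0)) :=
      tendsto_const_nhds.mul (tendsto_pow_atTop_nhds_zero_of_lt_one hq0.le hq1)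
    rw [mul_zero] at hg
    exact tendsto_of_tendsto_of_tendsto_of_le_of_le tendsto_const_nhds hg (fun j => (hν j).1.le)
      (fun j => (hν j).2)
  have hlq : 0 < Real.log (1 / q) := by
    rw [one_div, Real.log_inv]
    exact neg_pos.2 (Real.log_neg hq0 hq1)
  have hl4 : 0 < Real.log 4 := Real.log_pos (by norm_num)
  refine ⟨ν, E₀ / Real.log 4 + ΔE / Real.log (1 / q), c, hν4, hlim, hc, fun j => ?_⟩
  refine (hL j).mono fun N hN => ?_
  obtain ⟨U, hU, hE, hW⟩ := hN
  refine ⟨U, hU, hE.trans ?_, hW⟩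
  have hlog4 : Real.log 4 ≤ Real.log (1 / ν j) := log_four_le_log_one_div (hν4 j).1 (hν4 j).2
  have hlogq : (j : ℝ) * Real.log (1 / q) ≤ Real.log (1 / ν j) := by
    have h1 : (1 / q) ^ j ≤ 1 / ν j := by
      rw [one_div_pow]
      exact one_div_le_one_div_of_le (hν j).1 (hqj j)
    have h2 := Real.log_le_log (by positivity) h1
    rwa [Real.log_pow] at h2
  have hA : E₀ ≤ E₀ / Real.log 4 * Real.log (1 / ν j) :=
    calc E₀ = E₀ / Real.log 4 * Real.log 4 := (div_mul_cancel₀ E₀ hl4.ne').symm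
      _ ≤ E₀ / Real.log 4 * Real.log (1 / ν j) := mul_le_mul_of_nonneg_left hlog4 (div_nonneg hE₀ hl4.le)
  have hB : (j : ℝ) * ΔE ≤ ΔE / Real.log (1 / q) * Real.log (1 / ν j) :=
    calc (j : ℝ) * ΔE = ΔE / Real.log (1 / q) * ((j : ℝ) * Real.log (1 / q)) := by
          field_simp
      _ ≤ ΔE / Real.log (1 / q) * Real.log (1 / ν j) := mul_le_mul_of_nonneg_left hlogq (div_nonneg hΔE hlq.le)
  have hsplit : (E₀ / Real.log 4 + ΔE / Real.log (1 / q)) * Real.log (1 / ν j) =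
      E₀ / Real.log 4 * Real.log (1 / ν j) + ΔE / Real.log (1 / q) * Real.log (1 / ν j) := by ring
  linarith

/-- **Transfer to the route decl (proved):** an octave ladder for `f_TG` proves the crux. [folklore] -/
theorem crux_of_octaveLadder (h : OctaveLadder tgForce) :
    Summit.AnomalousDissipation.AnomalousDissipation.Theses.MirrorVariety.TaylorGreenLogLoudStates :=
  logCrux_iff.2 (logLoudStates_of_octaveLadder h)

/-- **Head-loss identity (Bernoulli with losses) along a streamline of a classical steady state.** For smooth `u`, `p`
with `(u·∇)u + ∇p = νΔu + f` pointwise on `T³` and an integral curve `γ` of the lifted field (`γ' = u ∘ proj ∘ γ`), the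
Bernoulli head `H = p + |u|²/2` satisfies `H(γ t₂) − H(γ t₁) = ∫_{t₁}^{t₂} ⟪νΔu + f, u⟫(γ t) dt`. Provable now (chain rule
for `H ∘ proj ∘ γ`, `⟪(u·∇)u, u⟫ = u·∇(|u|²/2)`, FTC). It is the formal root of the card's SUBSONIC-CORE LAW: a parcel
that threads a strained core of circulation `Γ` and Burgers radius `δ = (4ν/α)^{1/2}` loses head `κΓ²/δ²`,
`κ = ln 2/(4π²)` (Lamb–Oseen profile; = triage r1-1 (★)), and can re-enter ambient fluid only where `p ≤ H`, whence
`Γ/δ ≲ (2/κ)^{1/2}·U_amb` for every steady core: one generation of O(1)-many tubes strained by the O(1) cell dissipates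
`O(ν)`, sheets `O(ν^{1/2})`; a log-loud steady family must be a multi-generation LADDER. [folklore] -/
theorem head_loss_identity (ν : ℝ) (f u : UnitAddTorus (Fin 3) → EuclideanSpace ℝ (Fin 3))
    (p : UnitAddTorus (Fin 3) → ℝ) (hu : IsSmooth u) (hp : IsSmooth p) (hf : Continuous f)
    (hNS : ∀ x, convect u u x + gradient p x = ν • laplacian u x + f x)
    (γ : ℝ → EuclideanSpace ℝ (Fin 3)) (hγ : ∀ t, HasDerivAt γ (u (proj (γ t))) t) (t₁ t₂ : ℝ) :
    (p (proj (γ t₂)) + ‖u (proj (γ t₂))‖ ^ 2 / 2) - (p (proj (γ t₁)) + ‖u (proj (γ t₁))‖ ^ 2 / 2) =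
      ∫ t in t₁..t₂, ⟪ν • laplacian u (proj (γ t)) + f (proj (γ t)), u (proj (γ t))⟫_ℝ := by
  sorry

end Summit.AnomalousDissipation.AnomalousDissipation.Cruxes.TaylorGreenLogLoudStates.IdeasG2I2

end
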